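import Summits.CriticalPhenomena.PercolationContinuityZ3.Theorems.Transplant.FKDoubleFanMultifanC1CertA
import Summits.CriticalPhenomena.PercolationContinuityZ3.Theorems.Transplant.FKDoubleFanMultifanC1CertB
import Summits.CriticalPhenomena.PercolationContinuityZ3.Theorems.Transplant.FKDoubleFanMultifanC1CertC
import HarnessLib

/-!
# Double fans, MULTIFAN₁ middles: `𝒞₁ ≥ 0` — the second CORE-sized floor×roof³ coefficient of LEMMA‴ (assembly of the certificate)

Helper file (`--supports stmt-CriticalPhenomena-4575`), FK sub-lane `prim-bschramm-fk-3` (gen 34); builds on p205010 (kernel theorem, internal audit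
signed; external expert review pending).  Pure real polynomial algebra, no sorries; standard axioms.  Memo `bschramm/prim-bschramm-fk-3/FAR-CROSS-IX.md` §6–§6g.

`mfCone q t_g w_g t_u w_u t_s w_s` is the polynomial `𝒞₁` (368 terms): the coefficient of `Z_f·y_f` in the endpoint cell (floor `a`-fan `F = (0, y_f, Z_f, X_f, r_f)`,
roof `b`-fan `(t_g, w_g)`, roof input `(t_u, w_u)`, roof target `(t_s, w_s)`) of the four-leg Rayleigh difference of `…DoubleFanMultifan` (the cell is
`𝒜·Z_f(Z_f+r_f+X_f) + 𝒩·X_f(X_f+r_f+Z_f) + 𝒞₁·Z_f y_f + 𝒞₂·X_f y_f`, `𝒜` = gen 33's CORE).  THE CERTIFICATE (**`mfCone_decomp`**, one `ring`):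
  `𝒞₁ = 4(1−q)²·[(α + m₁)² + q·t_g·α²] + Σ_e t_g^{e₁} t_u^{e₂} t_s^{e₃}·R_e`,  `α = t_s w_g + t_u(w_g − w_s)`,  `m₁ = w_g(1−w_s)(1−w_u) − w_s w_u(1−w_g)`,
with the twenty remainder coefficients `R_e = mfConeR…` of `…MultifanC1CertA/B/C`, each `≥ 0` on `[0,1]⁴`; hence **`mfCone_nonneg`**: `𝒞₁ ≥ 0` for `t ≥ 0`,
`q, w ∈ [0,1]`.  (At `q = 0` this is the rank-one square `4(α+m₁)²` plus a non-negative affine-in-`t` remainder; at `q = 1` the polynomial is divisible by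
`(1+t_g)(1+t_u)(1+t_s)`.)
[folklore]
-/

noncomputable section

namespace Summit.CriticalPhenomena.PercolationContinuityZ3.Theorems

namespace FK

namespace ThreeApex

/-- Coefficient of `t_g^0 t_u^0 t_s^0` in `𝒞₁` (polynomial in `q, wg, wu, ws`). [folklore] -/
def mfConeC000 (q wg wu ws : ℝ) : ℝ :=
  (2 : ℝ) * q ^ 2 * wg ^ 2 * ws ^ 2 * wu ^ 2 + ((-8) : ℝ) * q * wg ^ 2 * ws ^ 2 * wu ^ 2 + ((-2) : ℝ) * q ^ 2 * wg ^ 2 * ws ^ 2 * wu + (4 : ℝ) * q * wg * ws ^ 2 * wu ^ 2 +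
    (4 : ℝ) * q * wg ^ 2 * ws * wu ^ 2 + (8 : ℝ) * q * wg ^ 2 * ws ^ 2 * wu + ((-1) : ℝ) * q ^ 2 * wg ^ 2 * ws ^ 2 + ((-1) : ℝ) * q ^ 2 * wg ^ 2 * wu ^ 2 +
    ((-1) : ℝ) * q ^ 2 * ws ^ 2 * wu ^ 2 + ((-8) : ℝ) * q * wg * ws * wu ^ 2 + ((-4) : ℝ) * q * wg * ws ^ 2 * wu + ((-4) : ℝ) * q * wg ^ 2 * ws * wu + (4 : ℝ) * q * wg ^ 2 * ws ^ 2 +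
    (4 : ℝ) * q * wg ^ 2 * wu ^ 2 + (4 : ℝ) * q * ws ^ 2 * wu ^ 2 + (2 : ℝ) * q ^ 2 * ws ^ 2 * wu + (8 : ℝ) * q * wg * ws * wu + ((-8) : ℝ) * q * ws ^ 2 * wu +
    (1 : ℝ) * q ^ 2 * wg ^ 2 + (8 : ℝ) * wg * ws * wu ^ 2 + ((-4) : ℝ) * wg ^ 2 * ws ^ 2 + ((-4) : ℝ) * wg ^ 2 * wu ^ 2 + ((-4) : ℝ) * ws ^ 2 * wu ^ 2 + ((-4) : ℝ) * q * wg ^ 2 +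
    ((-8) : ℝ) * wg * ws * wu + (8 : ℝ) * ws ^ 2 * wu + (4 : ℝ) * wg ^ 2

/-- Coefficient of `t_g^0 t_u^0 t_s^1` in `𝒞₁` (polynomial in `q, wg, wu, ws`). [folklore] -/
def mfConeC001 (q wg wu ws : ℝ) : ℝ :=
  (2 : ℝ) * q ^ 2 * wg ^ 2 * ws ^ 2 * wu ^ 2 + ((-8) : ℝ) * q * wg ^ 2 * ws ^ 2 * wu ^ 2 + ((-2) : ℝ) * q ^ 2 * wg ^ 2 * ws ^ 2 * wu + (1 : ℝ) * q ^ 3 * wg ^ 2 * wu ^ 2 +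
    ((-1) : ℝ) * q ^ 3 * ws ^ 2 * wu ^ 2 + (4 : ℝ) * q * wg * ws ^ 2 * wu ^ 2 + (4 : ℝ) * q * wg ^ 2 * ws * wu ^ 2 + (8 : ℝ) * q * wg ^ 2 * ws ^ 2 * wu +
    ((-1) : ℝ) * q ^ 2 * wg ^ 2 * ws ^ 2 + ((-5) : ℝ) * q ^ 2 * wg ^ 2 * wu ^ 2 + (4 : ℝ) * q ^ 2 * ws ^ 2 * wu ^ 2 + ((-2) : ℝ) * q ^ 3 * wg ^ 2 * wu +
    (2 : ℝ) * q ^ 3 * ws ^ 2 * wu + ((-8) : ℝ) * q * wg * ws * wu ^ 2 + ((-4) : ℝ) * q * wg * ws ^ 2 * wu + ((-4) : ℝ) * q * wg ^ 2 * ws * wu + (4 : ℝ) * q * wg ^ 2 * ws ^ 2 +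
    (8 : ℝ) * q * wg ^ 2 * wu ^ 2 + ((-4) : ℝ) * q * ws ^ 2 * wu ^ 2 + (8 : ℝ) * q ^ 2 * wg ^ 2 * wu + ((-8) : ℝ) * q ^ 2 * ws ^ 2 * wu + (8 : ℝ) * q * wg * ws * wu +
    ((-8) : ℝ) * q * wg ^ 2 * wu + (8 : ℝ) * q * ws ^ 2 * wu + (2 : ℝ) * q ^ 2 * wg ^ 2 + (8 : ℝ) * wg * ws * wu ^ 2 + ((-4) : ℝ) * wg ^ 2 * ws ^ 2 + ((-4) : ℝ) * wg ^ 2 * wu ^ 2 +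
    ((-8) : ℝ) * q * wg ^ 2 + ((-8) : ℝ) * wg * ws * wu + (8 : ℝ) * wg ^ 2

/-- Coefficient of `t_g^0 t_u^0 t_s^2` in `𝒞₁` (polynomial in `q, wg, wu`). [folklore] -/
def mfConeC002 (q wg wu : ℝ) : ℝ :=
  (1 : ℝ) * q ^ 3 * wg ^ 2 * wu ^ 2 + ((-4) : ℝ) * q ^ 2 * wg ^ 2 * wu ^ 2 + ((-2) : ℝ) * q ^ 3 * wg ^ 2 * wu + (4 : ℝ) * q * wg ^ 2 * wu ^ 2 + (8 : ℝ) * q ^ 2 * wg ^ 2 * wu +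
    ((-8) : ℝ) * q * wg ^ 2 * wu + (1 : ℝ) * q ^ 2 * wg ^ 2 + ((-4) : ℝ) * q * wg ^ 2 + (4 : ℝ) * wg ^ 2

/-- Coefficient of `t_g^0 t_u^1 t_s^0` in `𝒞₁` (polynomial in `q, wg, wu, ws`). [folklore] -/
def mfConeC010 (q wg wu ws : ℝ) : ℝ :=
  (2 : ℝ) * q ^ 2 * wg ^ 2 * ws ^ 2 * wu ^ 2 + ((-8) : ℝ) * q * wg ^ 2 * ws ^ 2 * wu ^ 2 + ((-2) : ℝ) * q ^ 2 * wg ^ 2 * ws ^ 2 * wu + (4 : ℝ) * q * wg * ws ^ 2 * wu ^ 2 +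
    (4 : ℝ) * q * wg ^ 2 * ws * wu ^ 2 + (8 : ℝ) * q * wg ^ 2 * ws ^ 2 * wu + ((-3) : ℝ) * q ^ 2 * wg ^ 2 * ws ^ 2 + ((-1) : ℝ) * q ^ 2 * wg ^ 2 * wu ^ 2 +
    ((-1) : ℝ) * q ^ 2 * ws ^ 2 * wu ^ 2 + ((-8) : ℝ) * q * wg * ws * wu ^ 2 + ((-4) : ℝ) * q * wg * ws ^ 2 * wu + ((-4) : ℝ) * q * wg ^ 2 * ws * wu + (8 : ℝ) * q * wg ^ 2 * ws ^ 2 +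
    (4 : ℝ) * q * wg ^ 2 * wu ^ 2 + (4 : ℝ) * q * ws ^ 2 * wu ^ 2 + (2 : ℝ) * q ^ 2 * wg * ws ^ 2 + (2 : ℝ) * q ^ 2 * wg ^ 2 * ws + (2 : ℝ) * q ^ 2 * ws ^ 2 * wu +
    (8 : ℝ) * q * wg * ws * wu + ((-4) : ℝ) * q * wg * ws ^ 2 + ((-4) : ℝ) * q * wg ^ 2 * ws + ((-8) : ℝ) * q * ws ^ 2 * wu + ((-4) : ℝ) * q ^ 2 * wg * ws +
    (2 : ℝ) * q ^ 2 * wg ^ 2 + (1 : ℝ) * q ^ 2 * ws ^ 2 + (8 : ℝ) * wg * ws * wu ^ 2 + ((-4) : ℝ) * wg ^ 2 * ws ^ 2 + ((-4) : ℝ) * wg ^ 2 * wu ^ 2 + ((-4) : ℝ) * ws ^ 2 * wu ^ 2 +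
    (12 : ℝ) * q * wg * ws + ((-8) : ℝ) * q * wg ^ 2 + ((-4) : ℝ) * q * ws ^ 2 + ((-8) : ℝ) * wg * ws * wu + (8 : ℝ) * ws ^ 2 * wu + ((-8) : ℝ) * wg * ws + (8 : ℝ) * wg ^ 2 +
    (4 : ℝ) * ws ^ 2

/-- Coefficient of `t_g^0 t_u^1 t_s^1` in `𝒞₁` (polynomial in `q, wg, wu, ws`). [folklore] -/
def mfConeC011 (q wg wu ws : ℝ) : ℝ :=
  (2 : ℝ) * q ^ 3 * wg ^ 2 * ws ^ 2 * wu ^ 2 + ((-8) : ℝ) * q ^ 2 * wg ^ 2 * ws ^ 2 * wu ^ 2 + ((-2) : ℝ) * q ^ 3 * wg ^ 2 * ws ^ 2 * wu + (4 : ℝ) * q ^ 2 * wg * ws ^ 2 * wu ^ 2 +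
    (4 : ℝ) * q ^ 2 * wg ^ 2 * ws * wu ^ 2 + (8 : ℝ) * q ^ 2 * wg ^ 2 * ws ^ 2 * wu + ((-1) : ℝ) * q ^ 3 * wg ^ 2 * ws ^ 2 + ((-1) : ℝ) * q ^ 3 * ws ^ 2 * wu ^ 2 +
    ((-8) : ℝ) * q ^ 2 * wg * ws * wu ^ 2 + ((-4) : ℝ) * q ^ 2 * wg * ws ^ 2 * wu + ((-4) : ℝ) * q ^ 2 * wg ^ 2 * ws * wu + (2 : ℝ) * q ^ 2 * wg ^ 2 * ws ^ 2 +
    (4 : ℝ) * q ^ 2 * ws ^ 2 * wu ^ 2 + ((-2) : ℝ) * q ^ 3 * wg ^ 2 * wu + (2 : ℝ) * q ^ 3 * ws ^ 2 * wu + (8 : ℝ) * q * wg * ws * wu ^ 2 + ((-4) : ℝ) * q * ws ^ 2 * wu ^ 2 +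
    (8 : ℝ) * q ^ 2 * wg * ws * wu + (2 : ℝ) * q ^ 2 * wg * ws ^ 2 + (2 : ℝ) * q ^ 2 * wg ^ 2 * ws + (8 : ℝ) * q ^ 2 * wg ^ 2 * wu + ((-8) : ℝ) * q ^ 2 * ws ^ 2 * wu +
    (1 : ℝ) * q ^ 3 * wg ^ 2 + (1 : ℝ) * q ^ 3 * ws ^ 2 + ((-8) : ℝ) * q * wg * ws * wu + ((-4) : ℝ) * q * wg * ws ^ 2 + ((-4) : ℝ) * q * wg ^ 2 * ws + ((-8) : ℝ) * q * wg ^ 2 * wu +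
    (8 : ℝ) * q * ws ^ 2 * wu + ((-4) : ℝ) * q ^ 2 * wg * ws + ((-2) : ℝ) * q ^ 2 * wg ^ 2 + ((-4) : ℝ) * q ^ 2 * ws ^ 2 + (12 : ℝ) * q * wg * ws + ((-4) : ℝ) * q * wg ^ 2 +
    (4 : ℝ) * q * ws ^ 2 + ((-8) : ℝ) * wg * ws + (8 : ℝ) * wg ^ 2

/-- Coefficient of `t_g^0 t_u^1 t_s^2` in `𝒞₁` (polynomial in `q, wg, wu`). [folklore] -/
def mfConeC012 (q wg wu : ℝ) : ℝ :=
  (1 : ℝ) * q ^ 4 * wg ^ 2 * wu ^ 2 + ((-4) : ℝ) * q ^ 3 * wg ^ 2 * wu ^ 2 + ((-2) : ℝ) * q ^ 4 * wg ^ 2 * wu + (4 : ℝ) * q ^ 2 * wg ^ 2 * wu ^ 2 + (8 : ℝ) * q ^ 3 * wg ^ 2 * wu +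
    ((-8) : ℝ) * q ^ 2 * wg ^ 2 * wu + (1 : ℝ) * q ^ 3 * wg ^ 2 + ((-4) : ℝ) * q ^ 2 * wg ^ 2 + (4 : ℝ) * q * wg ^ 2

/-- Coefficient of `t_g^0 t_u^2 t_s^0` in `𝒞₁` (polynomial in `q, wg, ws`). [folklore] -/
def mfConeC020 (q wg ws : ℝ) : ℝ :=
  ((-2) : ℝ) * q ^ 2 * wg ^ 2 * ws ^ 2 + (4 : ℝ) * q * wg ^ 2 * ws ^ 2 + (2 : ℝ) * q ^ 2 * wg * ws ^ 2 + (2 : ℝ) * q ^ 2 * wg ^ 2 * ws + ((-4) : ℝ) * q * wg * ws ^ 2 +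
    ((-4) : ℝ) * q * wg ^ 2 * ws + ((-4) : ℝ) * q ^ 2 * wg * ws + (1 : ℝ) * q ^ 2 * wg ^ 2 + (1 : ℝ) * q ^ 2 * ws ^ 2 + (12 : ℝ) * q * wg * ws + ((-4) : ℝ) * q * wg ^ 2 +
    ((-4) : ℝ) * q * ws ^ 2 + ((-8) : ℝ) * wg * ws + (4 : ℝ) * wg ^ 2 + (4 : ℝ) * ws ^ 2

/-- Coefficient of `t_g^0 t_u^2 t_s^1` in `𝒞₁` (polynomial in `q, wg, ws`). [folklore] -/
def mfConeC021 (q wg ws : ℝ) : ℝ :=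
  ((-2) : ℝ) * q ^ 3 * wg ^ 2 * ws ^ 2 + (4 : ℝ) * q ^ 2 * wg ^ 2 * ws ^ 2 + (2 : ℝ) * q ^ 3 * wg * ws ^ 2 + (2 : ℝ) * q ^ 3 * wg ^ 2 * ws + ((-4) : ℝ) * q ^ 2 * wg * ws ^ 2 +
    ((-4) : ℝ) * q ^ 2 * wg ^ 2 * ws + ((-4) : ℝ) * q ^ 3 * wg * ws + (1 : ℝ) * q ^ 3 * wg ^ 2 + (1 : ℝ) * q ^ 3 * ws ^ 2 + (12 : ℝ) * q ^ 2 * wg * ws + ((-4) : ℝ) * q ^ 2 * wg ^ 2 +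
    ((-4) : ℝ) * q ^ 2 * ws ^ 2 + ((-8) : ℝ) * q * wg * ws + (4 : ℝ) * q * wg ^ 2 + (4 : ℝ) * q * ws ^ 2

/-- Coefficient of `t_g^1 t_u^0 t_s^0` in `𝒞₁` (polynomial in `q, wg, wu, ws`). [folklore] -/
def mfConeC100 (q wg wu ws : ℝ) : ℝ :=
  (2 : ℝ) * q ^ 3 * wg ^ 2 * ws ^ 2 * wu ^ 2 + ((-8) : ℝ) * q ^ 2 * wg ^ 2 * ws ^ 2 * wu ^ 2 + ((-2) : ℝ) * q ^ 3 * wg ^ 2 * ws ^ 2 * wu + (4 : ℝ) * q ^ 2 * wg * ws ^ 2 * wu ^ 2 +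
    (4 : ℝ) * q ^ 2 * wg ^ 2 * ws * wu ^ 2 + (8 : ℝ) * q ^ 2 * wg ^ 2 * ws ^ 2 * wu + ((-1) : ℝ) * q ^ 3 * wg ^ 2 * ws ^ 2 + ((-1) : ℝ) * q ^ 3 * wg ^ 2 * wu ^ 2 +
    ((-1) : ℝ) * q ^ 3 * ws ^ 2 * wu ^ 2 + ((-8) : ℝ) * q ^ 2 * wg * ws * wu ^ 2 + ((-4) : ℝ) * q ^ 2 * wg * ws ^ 2 * wu + ((-4) : ℝ) * q ^ 2 * wg ^ 2 * ws * wu +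
    (4 : ℝ) * q ^ 2 * wg ^ 2 * ws ^ 2 + (4 : ℝ) * q ^ 2 * wg ^ 2 * wu ^ 2 + (5 : ℝ) * q ^ 2 * ws ^ 2 * wu ^ 2 + (2 : ℝ) * q ^ 3 * ws ^ 2 * wu + (8 : ℝ) * q * wg * ws * wu ^ 2 +
    ((-4) : ℝ) * q * wg ^ 2 * ws ^ 2 + ((-4) : ℝ) * q * wg ^ 2 * wu ^ 2 + ((-8) : ℝ) * q * ws ^ 2 * wu ^ 2 + (8 : ℝ) * q ^ 2 * wg * ws * wu + ((-8) : ℝ) * q ^ 2 * ws ^ 2 * wu +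
    (1 : ℝ) * q ^ 3 * wg ^ 2 + ((-8) : ℝ) * q * wg * ws * wu + (8 : ℝ) * q * ws ^ 2 * wu + ((-4) : ℝ) * q ^ 2 * wg ^ 2 + (4 : ℝ) * ws ^ 2 * wu ^ 2 + (4 : ℝ) * q * wg ^ 2

/-- Coefficient of `t_g^1 t_u^0 t_s^1` in `𝒞₁` (polynomial in `q, wg, wu, ws`). [folklore] -/
def mfConeC101 (q wg wu ws : ℝ) : ℝ :=
  (2 : ℝ) * q ^ 3 * wg ^ 2 * ws ^ 2 * wu ^ 2 + ((-8) : ℝ) * q ^ 2 * wg ^ 2 * ws ^ 2 * wu ^ 2 + ((-2) : ℝ) * q ^ 3 * wg ^ 2 * ws ^ 2 * wu + (1 : ℝ) * q ^ 4 * wg ^ 2 * wu ^ 2 +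
    ((-1) : ℝ) * q ^ 4 * ws ^ 2 * wu ^ 2 + (4 : ℝ) * q ^ 2 * wg * ws ^ 2 * wu ^ 2 + (4 : ℝ) * q ^ 2 * wg ^ 2 * ws * wu ^ 2 + (8 : ℝ) * q ^ 2 * wg ^ 2 * ws ^ 2 * wu +
    ((-1) : ℝ) * q ^ 3 * wg ^ 2 * ws ^ 2 + ((-5) : ℝ) * q ^ 3 * wg ^ 2 * wu ^ 2 + (5 : ℝ) * q ^ 3 * ws ^ 2 * wu ^ 2 + ((-2) : ℝ) * q ^ 4 * wg ^ 2 * wu +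
    (2 : ℝ) * q ^ 4 * ws ^ 2 * wu + ((-8) : ℝ) * q ^ 2 * wg * ws * wu ^ 2 + ((-4) : ℝ) * q ^ 2 * wg * ws ^ 2 * wu + ((-4) : ℝ) * q ^ 2 * wg ^ 2 * ws * wu +
    (4 : ℝ) * q ^ 2 * wg ^ 2 * ws ^ 2 + (8 : ℝ) * q ^ 2 * wg ^ 2 * wu ^ 2 + ((-8) : ℝ) * q ^ 2 * ws ^ 2 * wu ^ 2 + (8 : ℝ) * q ^ 3 * wg ^ 2 * wu + ((-8) : ℝ) * q ^ 3 * ws ^ 2 * wu +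
    (8 : ℝ) * q * wg * ws * wu ^ 2 + ((-4) : ℝ) * q * wg ^ 2 * ws ^ 2 + ((-4) : ℝ) * q * wg ^ 2 * wu ^ 2 + (4 : ℝ) * q * ws ^ 2 * wu ^ 2 + (8 : ℝ) * q ^ 2 * wg * ws * wu +
    ((-8) : ℝ) * q ^ 2 * wg ^ 2 * wu + (8 : ℝ) * q ^ 2 * ws ^ 2 * wu + (2 : ℝ) * q ^ 3 * wg ^ 2 + ((-8) : ℝ) * q * wg * ws * wu + ((-8) : ℝ) * q ^ 2 * wg ^ 2 + (8 : ℝ) * q * wg ^ 2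

/-- Coefficient of `t_g^1 t_u^0 t_s^2` in `𝒞₁` (polynomial in `q, wg, wu`). [folklore] -/
def mfConeC102 (q wg wu : ℝ) : ℝ :=
  (1 : ℝ) * q ^ 4 * wg ^ 2 * wu ^ 2 + ((-4) : ℝ) * q ^ 3 * wg ^ 2 * wu ^ 2 + ((-2) : ℝ) * q ^ 4 * wg ^ 2 * wu + (4 : ℝ) * q ^ 2 * wg ^ 2 * wu ^ 2 + (8 : ℝ) * q ^ 3 * wg ^ 2 * wu +
    ((-8) : ℝ) * q ^ 2 * wg ^ 2 * wu + (1 : ℝ) * q ^ 3 * wg ^ 2 + ((-4) : ℝ) * q ^ 2 * wg ^ 2 + (4 : ℝ) * q * wg ^ 2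

/-- Coefficient of `t_g^1 t_u^1 t_s^0` in `𝒞₁` (polynomial in `q, wg, wu, ws`). [folklore] -/
def mfConeC110 (q wg wu ws : ℝ) : ℝ :=
  (2 : ℝ) * q ^ 3 * wg ^ 2 * ws ^ 2 * wu ^ 2 + ((-8) : ℝ) * q ^ 2 * wg ^ 2 * ws ^ 2 * wu ^ 2 + ((-2) : ℝ) * q ^ 3 * wg ^ 2 * ws ^ 2 * wu + (4 : ℝ) * q ^ 2 * wg * ws ^ 2 * wu ^ 2 +
    (4 : ℝ) * q ^ 2 * wg ^ 2 * ws * wu ^ 2 + (8 : ℝ) * q ^ 2 * wg ^ 2 * ws ^ 2 * wu + ((-3) : ℝ) * q ^ 3 * wg ^ 2 * ws ^ 2 + ((-1) : ℝ) * q ^ 3 * wg ^ 2 * wu ^ 2 +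
    ((-8) : ℝ) * q ^ 2 * wg * ws * wu ^ 2 + ((-4) : ℝ) * q ^ 2 * wg * ws ^ 2 * wu + ((-4) : ℝ) * q ^ 2 * wg ^ 2 * ws * wu + (8 : ℝ) * q ^ 2 * wg ^ 2 * ws ^ 2 +
    (4 : ℝ) * q ^ 2 * wg ^ 2 * wu ^ 2 + (2 : ℝ) * q ^ 3 * wg * ws ^ 2 + (2 : ℝ) * q ^ 3 * wg ^ 2 * ws + (2 : ℝ) * q ^ 3 * ws ^ 2 * wu + (8 : ℝ) * q * wg * ws * wu ^ 2 +
    ((-4) : ℝ) * q * wg ^ 2 * ws ^ 2 + ((-4) : ℝ) * q * wg ^ 2 * wu ^ 2 + (8 : ℝ) * q ^ 2 * wg * ws * wu + ((-4) : ℝ) * q ^ 2 * wg * ws ^ 2 + ((-4) : ℝ) * q ^ 2 * wg ^ 2 * ws +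
    ((-8) : ℝ) * q ^ 2 * ws ^ 2 * wu + ((-4) : ℝ) * q ^ 3 * wg * ws + (2 : ℝ) * q ^ 3 * wg ^ 2 + (1 : ℝ) * q ^ 3 * ws ^ 2 + ((-8) : ℝ) * q * wg * ws * wu +
    (8 : ℝ) * q * ws ^ 2 * wu + (12 : ℝ) * q ^ 2 * wg * ws + ((-8) : ℝ) * q ^ 2 * wg ^ 2 + ((-4) : ℝ) * q ^ 2 * ws ^ 2 + ((-8) : ℝ) * q * wg * ws + (8 : ℝ) * q * wg ^ 2 +
    (4 : ℝ) * q * ws ^ 2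

/-- Coefficient of `t_g^1 t_u^1 t_s^1` in `𝒞₁` (polynomial in `q, wg, wu, ws`). [folklore] -/
def mfConeC111 (q wg wu ws : ℝ) : ℝ :=
  (2 : ℝ) * q ^ 4 * wg ^ 2 * ws ^ 2 * wu ^ 2 + ((-8) : ℝ) * q ^ 3 * wg ^ 2 * ws ^ 2 * wu ^ 2 + ((-2) : ℝ) * q ^ 4 * wg ^ 2 * ws ^ 2 * wu + (4 : ℝ) * q ^ 3 * wg * ws ^ 2 * wu ^ 2 +
    (4 : ℝ) * q ^ 3 * wg ^ 2 * ws * wu ^ 2 + (8 : ℝ) * q ^ 3 * wg ^ 2 * ws ^ 2 * wu + ((-1) : ℝ) * q ^ 4 * wg ^ 2 * ws ^ 2 + ((-8) : ℝ) * q ^ 3 * wg * ws * wu ^ 2 +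
    ((-4) : ℝ) * q ^ 3 * wg * ws ^ 2 * wu + ((-4) : ℝ) * q ^ 3 * wg ^ 2 * ws * wu + (2 : ℝ) * q ^ 3 * wg ^ 2 * ws ^ 2 + ((-2) : ℝ) * q ^ 4 * wg ^ 2 * wu +
    (2 : ℝ) * q ^ 4 * ws ^ 2 * wu + (8 : ℝ) * q ^ 2 * wg * ws * wu ^ 2 + (8 : ℝ) * q ^ 3 * wg * ws * wu + (2 : ℝ) * q ^ 3 * wg * ws ^ 2 + (2 : ℝ) * q ^ 3 * wg ^ 2 * ws +
    (8 : ℝ) * q ^ 3 * wg ^ 2 * wu + ((-8) : ℝ) * q ^ 3 * ws ^ 2 * wu + (1 : ℝ) * q ^ 4 * wg ^ 2 + (1 : ℝ) * q ^ 4 * ws ^ 2 + ((-8) : ℝ) * q ^ 2 * wg * ws * wu +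
    ((-4) : ℝ) * q ^ 2 * wg * ws ^ 2 + ((-4) : ℝ) * q ^ 2 * wg ^ 2 * ws + ((-8) : ℝ) * q ^ 2 * wg ^ 2 * wu + (8 : ℝ) * q ^ 2 * ws ^ 2 * wu + ((-4) : ℝ) * q ^ 3 * wg * ws +
    ((-2) : ℝ) * q ^ 3 * wg ^ 2 + ((-4) : ℝ) * q ^ 3 * ws ^ 2 + (12 : ℝ) * q ^ 2 * wg * ws + ((-4) : ℝ) * q ^ 2 * wg ^ 2 + (4 : ℝ) * q ^ 2 * ws ^ 2 + ((-8) : ℝ) * q * wg * ws +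
    (8 : ℝ) * q * wg ^ 2

/-- Coefficient of `t_g^1 t_u^1 t_s^2` in `𝒞₁` (polynomial in `q, wg, wu`). [folklore] -/
def mfConeC112 (q wg wu : ℝ) : ℝ :=
  (1 : ℝ) * q ^ 5 * wg ^ 2 * wu ^ 2 + ((-4) : ℝ) * q ^ 4 * wg ^ 2 * wu ^ 2 + ((-2) : ℝ) * q ^ 5 * wg ^ 2 * wu + (4 : ℝ) * q ^ 3 * wg ^ 2 * wu ^ 2 + (8 : ℝ) * q ^ 4 * wg ^ 2 * wu +
    ((-8) : ℝ) * q ^ 3 * wg ^ 2 * wu + (1 : ℝ) * q ^ 4 * wg ^ 2 + ((-4) : ℝ) * q ^ 3 * wg ^ 2 + (4 : ℝ) * q ^ 2 * wg ^ 2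

/-- Coefficient of `t_g^1 t_u^2 t_s^0` in `𝒞₁` (polynomial in `q, wg, ws`). [folklore] -/
def mfConeC120 (q wg ws : ℝ) : ℝ :=
  ((-2) : ℝ) * q ^ 3 * wg ^ 2 * ws ^ 2 + (4 : ℝ) * q ^ 2 * wg ^ 2 * ws ^ 2 + (2 : ℝ) * q ^ 3 * wg * ws ^ 2 + (2 : ℝ) * q ^ 3 * wg ^ 2 * ws + ((-4) : ℝ) * q ^ 2 * wg * ws ^ 2 +
    ((-4) : ℝ) * q ^ 2 * wg ^ 2 * ws + ((-4) : ℝ) * q ^ 3 * wg * ws + (1 : ℝ) * q ^ 3 * wg ^ 2 + (1 : ℝ) * q ^ 3 * ws ^ 2 + (12 : ℝ) * q ^ 2 * wg * ws + ((-4) : ℝ) * q ^ 2 * wg ^ 2 +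
    ((-4) : ℝ) * q ^ 2 * ws ^ 2 + ((-8) : ℝ) * q * wg * ws + (4 : ℝ) * q * wg ^ 2 + (4 : ℝ) * q * ws ^ 2

/-- Coefficient of `t_g^1 t_u^2 t_s^1` in `𝒞₁` (polynomial in `q, wg, ws`). [folklore] -/
def mfConeC121 (q wg ws : ℝ) : ℝ :=
  ((-2) : ℝ) * q ^ 4 * wg ^ 2 * ws ^ 2 + (4 : ℝ) * q ^ 3 * wg ^ 2 * ws ^ 2 + (2 : ℝ) * q ^ 4 * wg * ws ^ 2 + (2 : ℝ) * q ^ 4 * wg ^ 2 * ws + ((-4) : ℝ) * q ^ 3 * wg * ws ^ 2 +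
    ((-4) : ℝ) * q ^ 3 * wg ^ 2 * ws + ((-4) : ℝ) * q ^ 4 * wg * ws + (1 : ℝ) * q ^ 4 * wg ^ 2 + (1 : ℝ) * q ^ 4 * ws ^ 2 + (12 : ℝ) * q ^ 3 * wg * ws + ((-4) : ℝ) * q ^ 3 * wg ^ 2 +
    ((-4) : ℝ) * q ^ 3 * ws ^ 2 + ((-8) : ℝ) * q ^ 2 * wg * ws + (4 : ℝ) * q ^ 2 * wg ^ 2 + (4 : ℝ) * q ^ 2 * ws ^ 2

/-- Coefficient of `t_g^2 t_u^0 t_s^0` in `𝒞₁` (polynomial in `q, wu, ws`). [folklore] -/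
def mfConeC200 (q wu ws : ℝ) : ℝ :=
  (1 : ℝ) * q ^ 3 * ws ^ 2 * wu ^ 2 + ((-4) : ℝ) * q ^ 2 * ws ^ 2 * wu ^ 2 + (4 : ℝ) * q * ws ^ 2 * wu ^ 2

/-- Coefficient of `t_g^2 t_u^0 t_s^1` in `𝒞₁` (polynomial in `q, wu, ws`). [folklore] -/
def mfConeC201 (q wu ws : ℝ) : ℝ :=
  (1 : ℝ) * q ^ 4 * ws ^ 2 * wu ^ 2 + ((-4) : ℝ) * q ^ 3 * ws ^ 2 * wu ^ 2 + (4 : ℝ) * q ^ 2 * ws ^ 2 * wu ^ 2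

/-- Coefficient of `t_g^2 t_u^1 t_s^0` in `𝒞₁` (polynomial in `q, wu, ws`). [folklore] -/
def mfConeC210 (q wu ws : ℝ) : ℝ :=
  (1 : ℝ) * q ^ 4 * ws ^ 2 * wu ^ 2 + ((-4) : ℝ) * q ^ 3 * ws ^ 2 * wu ^ 2 + (4 : ℝ) * q ^ 2 * ws ^ 2 * wu ^ 2

/-- Coefficient of `t_g^2 t_u^1 t_s^1` in `𝒞₁` (polynomial in `q, wu, ws`). [folklore] -/
def mfConeC211 (q wu ws : ℝ) : ℝ :=
  (1 : ℝ) * q ^ 5 * ws ^ 2 * wu ^ 2 + ((-4) : ℝ) * q ^ 4 * ws ^ 2 * wu ^ 2 + (4 : ℝ) * q ^ 3 * ws ^ 2 * wu ^ 2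

/-- **`𝒞₁`**: the `Z_f·y_f` coefficient of the floor×roof³ endpoint cell of LEMMA‴ (368 terms, grouped by its twenty `t`-monomials; degree `≤ 2` in each of
`t_g, w_g, t_u, w_u, t_s, w_s`, `5` in `q`). [folklore] -/
def mfCone (q tg wg tu wu ts ws : ℝ) : ℝ :=
  mfConeC000 q wg wu ws + ts * mfConeC001 q wg wu ws + ts ^ 2 * mfConeC002 q wg wu + tu * mfConeC010 q wg wu ws + tu * ts * mfConeC011 q wg wu ws +
    tu * ts ^ 2 * mfConeC012 q wg wu + tu ^ 2 * mfConeC020 q wg ws + tu ^ 2 * ts * mfConeC021 q wg ws + tg * mfConeC100 q wg wu ws + tg * ts * mfConeC101 q wg wu ws +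
    tg * ts ^ 2 * mfConeC102 q wg wu + tg * tu * mfConeC110 q wg wu ws + tg * tu * ts * mfConeC111 q wg wu ws + tg * tu * ts ^ 2 * mfConeC112 q wg wu +
    tg * tu ^ 2 * mfConeC120 q wg ws + tg * tu ^ 2 * ts * mfConeC121 q wg ws + tg ^ 2 * mfConeC200 q wu ws + tg ^ 2 * ts * mfConeC201 q wu ws +
    tg ^ 2 * tu * mfConeC210 q wu ws + tg ^ 2 * tu * ts * mfConeC211 q wu ws

set_option maxHeartbeats 16000000 in
/-- **The `𝒞₁` certificate identity**: rank-one square `+ q·t_g·α²`, times `4(1−q)²`, plus the twenty certified remainders. [folklore] -/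
theorem mfCone_decomp (q tg wg tu wu ts ws : ℝ) :
    mfCone q tg wg tu wu ts ws =
      4 * (1 - q) ^ 2 * ((ts * wg + tu * (wg - ws) + (wg * (1 - ws) * (1 - wu) - ws * wu * (1 - wg))) ^ 2 + q * tg * (ts * wg + tu * (wg - ws)) ^ 2) +
      (mfConeR000 q wg wu ws + ts * mfConeR001 q wg wu ws + ts ^ 2 * mfConeR002 q wg wu + tu * mfConeR010 q wg wu ws + tu * ts * mfConeR011 q wg wu ws +
       tu * ts ^ 2 * mfConeR012 q wg wu + tu ^ 2 * mfConeR020 q wg ws + tu ^ 2 * ts * mfConeR021 q wg ws + tg * mfConeR100 q wg wu ws + tg * ts * mfConeR101 q wg wu ws +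
       tg * ts ^ 2 * mfConeR102 q wg wu + tg * tu * mfConeR110 q wg wu ws + tg * tu * ts * mfConeR111 q wg wu ws + tg * tu * ts ^ 2 * mfConeR112 q wg wu +
       tg * tu ^ 2 * mfConeR120 q wg ws + tg * tu ^ 2 * ts * mfConeR121 q wg ws + tg ^ 2 * mfConeR200 q wu ws + tg ^ 2 * ts * mfConeR201 q wu ws +
       tg ^ 2 * tu * mfConeR210 q wu ws + tg ^ 2 * tu * ts * mfConeR211 q wu ws) := by
  simp only [mfCone, mfConeC000, mfConeC001, mfConeC002, mfConeC010, mfConeC011, mfConeC012, mfConeC020, mfConeC021, mfConeC100, mfConeC101, mfConeC102, mfConeC110, mfConeC111, mfConeC112, mfConeC120, mfConeC121, mfConeC200, mfConeC201, mfConeC210, mfConeC211, mfConeR000, mfConeR001, mfConeR002, mfConeR010, mfConeR011, mfConeR012, mfConeR020, mfConeR021, mfConeR100, mfConeR101, mfConeR102, mfConeR110, mfConeR111, mfConeR112, mfConeR120, mfConeR121, mfConeR200, mfConeR201, mfConeR210, mfConeR211]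
  ring

/-- **`𝒞₁ ≥ 0`** on `t_g, t_u, t_s ≥ 0`, `q, w_g, w_u, w_s ∈ [0,1]`. [folklore] -/
theorem mfCone_nonneg {q tg wg tu wu ts ws : ℝ} (hq0 : 0 ≤ q) (hq1 : q ≤ 1) (htg : 0 ≤ tg) (hwg0 : 0 ≤ wg) (hwg1 : wg ≤ 1) (htu : 0 ≤ tu)
    (hwu0 : 0 ≤ wu) (hwu1 : wu ≤ 1) (hts : 0 ≤ ts) (hws0 : 0 ≤ ws) (hws1 : ws ≤ 1) : 0 ≤ mfCone q tg wg tu wu ts ws := by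
  have h000 : 0 ≤ mfConeR000 q wg wu ws := mfConeR000_nonneg hq0 hq1 hwg0 hwg1 hwu0 hwu1 hws0 hws1
  have h001 : 0 ≤ mfConeR001 q wg wu ws := mfConeR001_nonneg hq0 hq1 hwg0 hwg1 hwu0 hwu1 hws0 hws1
  have h002 : 0 ≤ mfConeR002 q wg wu := mfConeR002_nonneg hq0 hq1 hwu0 hwu1
  have h010 : 0 ≤ mfConeR010 q wg wu ws := mfConeR010_nonneg hq0 hq1 hwg0 hwg1 hwu0 hwu1 hws0 hws1
  have h011 : 0 ≤ mfConeR011 q wg wu ws := mfConeR011_nonneg hq0 hq1 hwg0 hwg1 hwu0 hwu1 hws0 hws1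
  have h012 : 0 ≤ mfConeR012 q wg wu := mfConeR012_nonneg hq0 hq1 hwu0 hwu1
  have h020 : 0 ≤ mfConeR020 q wg ws := mfConeR020_nonneg hq0 hq1
  have h021 : 0 ≤ mfConeR021 q wg ws := mfConeR021_nonneg hq0 hq1
  have h100 : 0 ≤ mfConeR100 q wg wu ws := mfConeR100_nonneg hq0 hq1 hwg0 hwg1 hwu0 hwu1 hws0 hws1
  have h101 : 0 ≤ mfConeR101 q wg wu ws := mfConeR101_nonneg hq0 hq1 hwg0 hwg1 hwu0 hwu1 hws0 hws1
  have h102 : 0 ≤ mfConeR102 q wg wu := mfConeR102_nonneg hq0 hq1 hwu0 hwu1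
  have h110 : 0 ≤ mfConeR110 q wg wu ws := mfConeR110_nonneg hq0 hq1 hwg0 hwg1 hwu0 hwu1 hws0 hws1
  have h111 : 0 ≤ mfConeR111 q wg wu ws := mfConeR111_nonneg hq0 hq1 hwg0 hwg1 hwu0 hwu1 hws0 hws1
  have h112 : 0 ≤ mfConeR112 q wg wu := mfConeR112_nonneg hq0 hq1 hwu0 hwu1
  have h120 : 0 ≤ mfConeR120 q wg ws := mfConeR120_nonneg hq0 hq1
  have h121 : 0 ≤ mfConeR121 q wg ws := mfConeR121_nonneg hq0 hq1 hwg0 hwg1 hws0 hws1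
  have h200 : 0 ≤ mfConeR200 q wu ws := mfConeR200_nonneg hq0 hq1
  have h201 : 0 ≤ mfConeR201 q wu ws := mfConeR201_nonneg hq0 hq1
  have h210 : 0 ≤ mfConeR210 q wu ws := mfConeR210_nonneg hq0 hq1
  have h211 : 0 ≤ mfConeR211 q wu ws := mfConeR211_nonneg hq0 hq1
  rw [mfCone_decomp]
  positivity

end ThreeApex

end FK

end Summit.CriticalPhenomena.PercolationContinuityZ3.Theorems
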